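import Summits.Schanuel.Schanuel.Theorems.SoloInformedRealGraphSector
import Literature.NumberTheory.Transcendental.BakerCoefficientForm
import Literature.NumberTheory.Transcendental.PhilipponCriterionProofs
import Literature.Barriers.Schanuel.EFunctionValuesAtAlgebraicPoints

/-!
# The torsion floor below `e ⟂ π` and Baker's dichotomy at `e^e` (soloist Proposition T)

Soloist file (`solo-Schanuel-informed`, residency session s12, 2026-08-19), companion of
`SoloInformedPiELadder` (the ladder `SC(2)@(1, iπ) ⟺ e ⟂ π ⟹ …`,
`two_le_trdeg_expField_one_piI_iff`) and `SoloInformedRealGraphSector`.  It records,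
kernel-checked, the FLOOR of that ladder: the weakest consequences of Schanuel's conjecture at
the emblematic point `(1, iπ)` that are still undecided, typed as TORSION statements on the unit
circle, together with the one unconditional dichotomy that Baker's theorem leaves there.
Nothing here is deep; the point is the exact typing (atlas §1 F4′ of the soloist's statement).

## Statements

* §1 (exact sequence `0 → 2πiℤ → iℝ → S¹`).  For real `θ ≠ 0`:
  `(∃ n ≥ 1, (e^{iθ})ⁿ = 1) ⟺ π/θ ∈ ℚ` (`exists_pow_cexp_mul_I_eq_one_iff`).  Hence
  `π/e ∉ ℚ ⟺ e^{ie}` is not a root of unity and `eπ ∉ ℚ ⟺ e^{i/e}` is not a root of unity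
  (`irrational_pi_div_exp_one_iff`, `irrational_exp_one_mul_pi_iff`), and the integer linear
  forms in `1, e, π` are all non-zero iff no `e^{i(a+be)}`, `(a, b) ∈ ℤ² ∖ 0`, is a root of
  unity (`intLinearForms_one_e_pi_iff_torsionFree`; `ℚ`-linear independence of `1, e, π` is the
  same statement, `linearIndependent_one_e_pi_iff`).
* §2 (Baker's dichotomy).  IF `e^e` were algebraic, Baker's theorem on linear forms in the
  logarithms `e = log (e^e)` and `iπ = log (−1)` [Baker1975, Thm 2.1] would make `1, e, π`
  linearly independent over `ℚ̄` (`baker_one_e_pi_of_isAlgebraic_exp_exp_one`); unconditionally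
  therefore: `e^e` is transcendental OR (`e + π` and `π/e` are transcendental and `1, e, π` are
  `ℚ`-linearly independent) (`transcendental_exp_exp_one_or`).  Compare the Brownawell–Waldschmidt
  dichotomy "`e^e` or `e^{e²}` is transcendental" [Baker1975, p. 111].
* §3 (summit side).  `e ⟂ π` (`ExpOnePiAlgebraicIndependent`) gives all of §1's conclusions
  (`floor_of_expOnePiAlgebraicIndependent`); `SchanuelRank 2` at the neighbouring points
  `(1, ie)` and `(1, i/e)` gives the transcendence of `e^{ie}` and `e^{i/e}`
  (`transcendental_cexp_exp_one_mul_I_of_schanuelRank_two`,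
  `transcendental_cexp_inv_exp_one_mul_I_of_schanuelRank_two`); the summit gives everything
  (`floor_of_schanuel`).

## Reading (atlas §1 F4′)

The weakest undecided consequence of `SC(2)` at `(1, iπ)` visible in the tree is the TORSION
CASE of Hermite–Lindemann at the transcendental point `ie`: "`exp (i · exp 1)` is not a root of
unity" (`⟺ π/e ∉ ℚ`).  The printed criteria for "`e^{iθ}` (`θ` real) is not a root of unity" are
`θ ∈ ℚ̄ ∖ 0` (Hermite–Lindemann) and `θ ∈ (ℚ̄-span of logarithms of algebraic numbers) ∖ ℚπ`
(Baker); for `θ = e` the second reads "`e^e ∈ ℚ̄`", whence §2 and nothing more.  The sources we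
searched list `e + π`, `eπ`, `π^e` among the open irrationalities [Laczkovich2001, p. 4 and
p. 23], [Angell2022, §1.4], [Waldschmidt2004, §2.3], not `π/e`; we know no proof of
`π/e ∉ ℚ` short of the (open) `ℚ`-linear independence of `1, e, π`.

## References

* [Baker1975] A. Baker, *Transcendental Number Theory*, Cambridge Univ. Press 1975:
  Theorem 2.1 (Ch. 2); p. 111 (Brownawell–Waldschmidt, Theorem 12.2 and its corollary).
* [Laczkovich2001] M. Laczkovich, *Conjecture and Proof*, MAA 2001, p. 4 and p. 23.
* [Angell2022] D. Angell, *Irrationality and Transcendence in Number Theory*, CRC Press 2022, §1.4.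
* [Waldschmidt2004] M. Waldschmidt, Open Diophantine problems, Moscow Math. J. 4 (2004), §2.3
  (arXiv:math/0312440).
-/

noncomputable section

open Complex IntermediateField
open Literature.NumberTheory.Transcendental (ExpOnePiAlgebraicIndependent SchanuelRank
  baker_coeff_eq_zero)
open Literature.NumberTheory.Transcendental.Philippon1986_criterion (trdeg_adjoin_range_le)
open Literature.Barriers.Schanuel (trdeg_mono trdeg_adjoin_union_eq_of_isAlgebraic isAlgebraic_I
  transcendental_add_of_algebraicIndependent transcendental_mul_of_algebraicIndependent)

namespace Summit.Schanuel.Schanuel.Theorems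

/-! ### §1 Torsion on the unit circle versus rational multiples of `π` -/

/-- `(e^{iθ})ⁿ = 1 ⟹ nθ ∈ 2πℤ`. -/
theorem exists_int_of_cexp_mul_I_pow_eq_one {θ : ℝ} {n : ℕ}
    (h : cexp ((θ : ℂ) * I) ^ n = 1) : ∃ k : ℤ, (n : ℝ) * θ = 2 * Real.pi * k := by
  rw [← Complex.exp_nat_mul, Complex.exp_eq_one_iff] at h
  obtain ⟨k, hk⟩ := h
  refine ⟨k, ?_⟩
  have h2 : (((n : ℝ) * θ : ℝ) : ℂ) * I = ((2 * Real.pi * k : ℝ) : ℂ) * I := by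
    push_cast
    linear_combination hk
  exact_mod_cast mul_right_cancel₀ I_ne_zero h2

/-- `nθ ∈ 2πℤ ⟹ (e^{iθ})ⁿ = 1`. -/
theorem cexp_mul_I_pow_eq_one_of_eq {θ : ℝ} {n : ℕ} {k : ℤ}
    (h : (n : ℝ) * θ = 2 * Real.pi * k) : cexp ((θ : ℂ) * I) ^ n = 1 := by
  rw [← Complex.exp_nat_mul]
  have h2 : (n : ℂ) * ((θ : ℂ) * I) = (k : ℂ) * (2 * Real.pi * I) := by
    have h' := congrArg (fun x : ℝ => (x : ℂ) * I) h
    push_cast at h'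
    linear_combination h'
  rw [h2]
  exact Complex.exp_int_mul_two_pi_mul_I k

/-- **Exactness of `exp` on `iℝ`.** For real `θ ≠ 0`: `e^{iθ}` is a root of unity iff
`π/θ ∈ ℚ`. -/
theorem exists_pow_cexp_mul_I_eq_one_iff {θ : ℝ} (hθ : θ ≠ 0) :
    (∃ n : ℕ, 0 < n ∧ cexp ((θ : ℂ) * I) ^ n = 1) ↔ ∃ q : ℚ, (q : ℝ) = Real.pi / θ := by
  constructor
  · rintro ⟨n, hn, h⟩
    obtain ⟨k, hk⟩ := exists_int_of_cexp_mul_I_pow_eq_one h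
    have hk0 : (k : ℝ) ≠ 0 := by
      rintro hk0
      rw [hk0, mul_zero] at hk
      exact (mul_ne_zero (by exact_mod_cast hn.ne') hθ) hk
    refine ⟨(n : ℚ) / (2 * k), ?_⟩
    push_cast
    rw [div_eq_div_iff (mul_ne_zero two_ne_zero hk0) hθ]
    linear_combination hk
  · rintro ⟨q, hq⟩
    rw [Rat.cast_def, div_eq_div_iff (by exact_mod_cast q.den_nz : (q.den : ℝ) ≠ 0) hθ] at hq
    -- `hq : q.num * θ = π * q.den`
    have hq0 : q.num ≠ 0 := by
      rintro h0
      rw [h0, Int.cast_zero, zero_mul] at hq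
      exact mul_ne_zero Real.pi_ne_zero (by exact_mod_cast q.den_nz : (q.den : ℝ) ≠ 0) hq.symm
    refine ⟨2 * q.num.natAbs, Nat.mul_pos two_pos (Int.natAbs_pos.mpr hq0), ?_⟩
    have habs : ((q.num.natAbs : ℕ) : ℝ) = |(q.num : ℝ)| := by
      rw [Nat.cast_natAbs, Int.cast_abs]
    rcases le_or_gt 0 q.num with hpos | hneg
    · apply cexp_mul_I_pow_eq_one_of_eq (k := (q.den : ℤ))
      rw [Nat.cast_mul, Nat.cast_ofNat, habs, abs_of_nonneg (by exact_mod_cast hpos),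
        Int.cast_natCast]
      linear_combination 2 * hq
    · apply cexp_mul_I_pow_eq_one_of_eq (k := -(q.den : ℤ))
      rw [Nat.cast_mul, Nat.cast_ofNat, habs, abs_of_neg (by exact_mod_cast hneg), Int.cast_neg,
        Int.cast_natCast]
      linear_combination (-2) * hq

/-- **`π/e ∉ ℚ ⟺ e^{ie}` is not a root of unity** — the weakest undecided consequence of
Schanuel's conjecture at `(1, iπ)`: the torsion case of Hermite–Lindemann at the transcendental
point `ie`. -/
theorem irrational_pi_div_exp_one_iff :
    Irrational (Real.pi / Real.exp 1) ↔ ∀ n : ℕ, 0 < n → cexp (cexp 1 * I) ^ n ≠ 1 := by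
  have key := exists_pow_cexp_mul_I_eq_one_iff (Real.exp_pos 1).ne'
  rw [Complex.ofReal_exp, Complex.ofReal_one] at key
  simp only [Irrational, Set.mem_range, ← key, not_exists, not_and, ne_eq]

/-- **`eπ ∉ ℚ ⟺ e^{i/e}` is not a root of unity.** -/
theorem irrational_exp_one_mul_pi_iff :
    Irrational (Real.exp 1 * Real.pi) ↔ ∀ n : ℕ, 0 < n → cexp ((cexp 1)⁻¹ * I) ^ n ≠ 1 := by
  have key := exists_pow_cexp_mul_I_eq_one_iff (inv_ne_zero (Real.exp_pos 1).ne')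
  rw [Complex.ofReal_inv, Complex.ofReal_exp, Complex.ofReal_one, div_inv_eq_mul,
    mul_comm Real.pi (Real.exp 1)] at key
  simp only [Irrational, Set.mem_range, ← key, not_exists, not_and, ne_eq]

/-- Cast of an integer form `a + be` from `ℝ` to `ℂ`. -/
theorem cast_intForm (a b : ℤ) :
    ((((a : ℝ) + b * Real.exp 1 : ℝ)) : ℂ) = (a : ℂ) + b * cexp 1 := by
  simp [Complex.ofReal_exp]

/-- **Integer linear forms in `1, e, π` versus torsion.** Every non-trivial integer linear form
in `1, e, π` is non-zero iff no `e^{i(a + be)}` with `(a, b) ∈ ℤ² ∖ 0` is a root of unity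
(i.e. `e^{i}` and `e^{ie}` are multiplicatively independent modulo torsion). -/
theorem intLinearForms_one_e_pi_iff_torsionFree :
    (∀ a b c : ℤ, (a : ℝ) + b * Real.exp 1 + c * Real.pi = 0 → a = 0 ∧ b = 0 ∧ c = 0) ↔
      ∀ a b : ℤ, (∃ n : ℕ, 0 < n ∧ cexp (((a : ℂ) + b * cexp 1) * I) ^ n = 1) →
        a = 0 ∧ b = 0 := by
  constructor
  · rintro h a b ⟨n, hn, hpow⟩
    rw [← cast_intForm] at hpow
    obtain ⟨k, hk⟩ := exists_int_of_cexp_mul_I_pow_eq_one hpow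
    have h3 := h (n * a) (n * b) (-(2 * k)) (by push_cast; linear_combination hk)
    have hn' : (n : ℤ) ≠ 0 := by exact_mod_cast hn.ne'
    exact ⟨(mul_eq_zero.mp h3.1).resolve_left hn', (mul_eq_zero.mp h3.2.1).resolve_left hn'⟩
  · intro h a b c habc
    have hab : a = 0 ∧ b = 0 := by
      refine h a b ⟨2, two_pos, ?_⟩
      rw [← cast_intForm]
      exact cexp_mul_I_pow_eq_one_of_eq (k := -c) (by push_cast; linear_combination 2 * habc)
    obtain ⟨rfl, rfl⟩ := hab
    have hc : (c : ℝ) * Real.pi = 0 := by simpa using habc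
    exact ⟨rfl, rfl, by exact_mod_cast (mul_eq_zero.mp hc).resolve_right Real.pi_ne_zero⟩

/-- `ℚ`-linear independence of `1, e, π` is the vanishing criterion for INTEGER linear forms. -/
theorem linearIndependent_one_e_pi_iff :
    LinearIndependent ℚ ![(1 : ℝ), Real.exp 1, Real.pi] ↔
      ∀ a b c : ℤ, (a : ℝ) + b * Real.exp 1 + c * Real.pi = 0 → a = 0 ∧ b = 0 ∧ c = 0 := by
  rw [← LinearIndependent.iff_fractionRing ℤ ℚ, Fintype.linearIndependent_iff]
  constructor
  · intro h a b c habc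
    have h0 := h ![a, b, c] (by simpa [Fin.sum_univ_three, zsmul_eq_mul] using habc)
    exact ⟨by simpa using h0 0, by simpa using h0 1, by simpa using h0 2⟩
  · intro h g hg
    have h3 := h (g 0) (g 1) (g 2) (by simpa [Fin.sum_univ_three, zsmul_eq_mul] using hg)
    intro i
    fin_cases i
    · exact h3.1
    · exact h3.2.1
    · exact h3.2.2

/-! ### §2 Baker's dichotomy at `e^e` -/

/-- **If `e^e` were algebraic, `1, e, π` would be linearly independent over `ℚ̄`**: Baker's
theorem [Baker1975, Thm 2.1] at the logarithms `e = log (e^e)`, `iπ = log (−1)` (which are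
`ℚ`-linearly independent: real and imaginary parts). -/
theorem baker_one_e_pi_of_isAlgebraic_exp_exp_one (he : IsAlgebraic ℚ (cexp (cexp 1)))
    {β₀ β₁ β₂ : ℂ} (h₀ : IsAlgebraic ℚ β₀) (h₁ : IsAlgebraic ℚ β₁) (h₂ : IsAlgebraic ℚ β₂)
    (h : β₀ + β₁ * cexp 1 + β₂ * Real.pi = 0) : β₀ = 0 ∧ β₁ = 0 ∧ β₂ = 0 := by
  have hIalg : IsAlgebraic ℚ I := isAlgebraic_I
  have halg : ∀ i, IsAlgebraic ℚ (cexp (![cexp 1, (Real.pi : ℂ) * I] i)) := by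
    intro i
    fin_cases i
    · simpa using he
    · simpa [Complex.exp_pi_mul_I] using isAlgebraic_one.neg
  have hli : LinearIndependent ℚ ![cexp 1, (Real.pi : ℂ) * I] := by
    have h' := linearIndependent_re_imI (Real.exp_pos 1).ne' Real.pi_ne_zero
    rwa [Complex.ofReal_exp, Complex.ofReal_one] at h'
  have hβ : ∀ i, IsAlgebraic ℚ (![β₁, -I * β₂] i) := by
    intro i
    fin_cases i
    · simpa using h₁
    · simpa using (hIalg.neg).mul h₂
  have hsum : β₀ + ∑ i, ![β₁, -I * β₂] i * ![cexp 1, (Real.pi : ℂ) * I] i = 0 := by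
    rw [Fin.sum_univ_two]
    simp only [Matrix.cons_val_zero, Matrix.cons_val_one, Matrix.cons_val_fin_one]
    linear_combination (norm := ring_nf) h
    rw [Complex.I_sq]; ring
  obtain ⟨hb0, hb⟩ := baker_coeff_eq_zero _ halg hli h₀ hβ hsum
  refine ⟨hb0, by simpa using hb 0, ?_⟩
  have h1 : -I * β₂ = 0 := by simpa using hb 1
  simpa [I_ne_zero] using h1

/-- **Baker's dichotomy (unconditional).** Either `e^e` is transcendental, or every linear
relation `β₀ + β₁ e + β₂ π = 0` with algebraic `βᵢ` is trivial. -/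
theorem transcendental_exp_exp_one_or_baker_floor :
    Transcendental ℚ (Real.exp (Real.exp 1)) ∨
      ∀ β₀ β₁ β₂ : ℂ, IsAlgebraic ℚ β₀ → IsAlgebraic ℚ β₁ → IsAlgebraic ℚ β₂ →
        β₀ + β₁ * cexp 1 + β₂ * Real.pi = 0 → β₀ = 0 ∧ β₁ = 0 ∧ β₂ = 0 := by
  by_cases he : IsAlgebraic ℚ (Real.exp (Real.exp 1))
  · right
    have he' : IsAlgebraic ℚ (cexp (cexp 1)) := by
      have h1 := he.algebraMap (A := ℂ)
      rwa [show algebraMap ℝ ℂ (Real.exp (Real.exp 1)) = cexp (cexp 1) by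
        rw [Complex.coe_algebraMap, Complex.ofReal_exp, Complex.ofReal_exp,
          Complex.ofReal_one]] at h1
    intro β₀ β₁ β₂ h₀ h₁ h₂ h
    exact baker_one_e_pi_of_isAlgebraic_exp_exp_one he' h₀ h₁ h₂ h
  · exact Or.inl he

/-- **Corollary.** `e^e` is transcendental, or else `e + π` and `π/e` are transcendental and
`1, e, π` are `ℚ`-linearly independent. -/
theorem transcendental_exp_exp_one_or :
    Transcendental ℚ (Real.exp (Real.exp 1)) ∨
      (Transcendental ℚ (Real.exp 1 + Real.pi) ∧ Transcendental ℚ (Real.pi / Real.exp 1) ∧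
        LinearIndependent ℚ ![(1 : ℝ), Real.exp 1, Real.pi]) := by
  refine transcendental_exp_exp_one_or_baker_floor.imp_right fun h => ⟨?_, ?_, ?_⟩
  · -- `e + π = β` algebraic ⟹ `-β + 1·e + 1·π = 0`
    intro hβ
    have hβ' : IsAlgebraic ℚ (((Real.exp 1 + Real.pi : ℝ)) : ℂ) := by
      simpa [Complex.coe_algebraMap] using hβ.algebraMap (A := ℂ)
    have := h (-(((Real.exp 1 + Real.pi : ℝ)) : ℂ)) 1 1 hβ'.neg isAlgebraic_one isAlgebraic_one
      (by push_cast; ring)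
    exact one_ne_zero this.2.1
  · -- `π/e = β` algebraic ⟹ `0 + β·e - π = 0`
    intro hβ
    have hβ' : IsAlgebraic ℚ (((Real.pi / Real.exp 1 : ℝ)) : ℂ) := by
      simpa [Complex.coe_algebraMap] using hβ.algebraMap (A := ℂ)
    have he0 : cexp 1 ≠ 0 := Complex.exp_ne_zero 1
    have := h 0 (((Real.pi / Real.exp 1 : ℝ)) : ℂ) (-1) isAlgebraic_zero hβ' isAlgebraic_one.neg
      (by push_cast; rw [div_mul_cancel₀ (Real.pi : ℂ) he0]; ring)
    exact neg_ne_zero.mpr one_ne_zero this.2.2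
  · rw [linearIndependent_one_e_pi_iff]
    intro a b c habc
    have := h a b c (isAlgebraic_int a) (isAlgebraic_int b) (isAlgebraic_int c)
      (by have h' := congrArg ((↑) : ℝ → ℂ) habc; push_cast at h'; exact h')
    exact_mod_cast this

/-! ### §3 Summit side: what `e ⟂ π`, `SchanuelRank 2` and the summit give at the floor -/

/-- `e ⟂ π` kills every non-trivial integer (indeed rational) linear form in `1, e, π`. -/
theorem intLinearForms_of_expOnePiAlgebraicIndependent (h : ExpOnePiAlgebraicIndependent)
    (a b c : ℤ) (habc : (a : ℝ) + b * Real.exp 1 + c * Real.pi = 0) : a = 0 ∧ b = 0 ∧ c = 0 := by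
  set P : MvPolynomial (Fin 2) ℚ :=
    MvPolynomial.C (a : ℚ) + MvPolynomial.C (b : ℚ) * MvPolynomial.X 0 +
      MvPolynomial.C (c : ℚ) * MvPolynomial.X 1 with hP
  have hPx : MvPolynomial.aeval ![Real.exp 1, Real.pi] P = 0 := by
    simp only [hP, map_add, map_mul, MvPolynomial.aeval_C, MvPolynomial.aeval_X,
      Matrix.cons_val_zero, Matrix.cons_val_one, Matrix.cons_val_fin_one, eq_ratCast,
      Rat.cast_intCast]
    exact habc
  have hP0 : P = 0 := h (by rw [hPx, map_zero])
  have ea := congrArg (MvPolynomial.aeval ![(0 : ℚ), 0]) hP0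
  have eb := congrArg (MvPolynomial.aeval ![(1 : ℚ), 0]) hP0
  have ec := congrArg (MvPolynomial.aeval ![(0 : ℚ), 1]) hP0
  simp only [hP, map_add, map_mul, MvPolynomial.aeval_C, MvPolynomial.aeval_X, map_zero,
    Matrix.cons_val_zero, Matrix.cons_val_one, Matrix.cons_val_fin_one, mul_zero, mul_one,
    add_zero, eq_ratCast, Rat.cast_intCast] at ea eb ec
  refine ⟨by exact_mod_cast ea, ?_, ?_⟩
  · rw [ea, zero_add] at eb; exact_mod_cast eb
  · rw [ea, zero_add] at ec; exact_mod_cast ec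

/-- **`e ⟂ π ⟹` the whole floor**: `1, e, π` `ℚ`-linearly independent, `π/e ∉ ℚ`, `eπ ∉ ℚ`,
hence `e^{ie}`, `e^{i/e}` and all `e^{i(a+be)}` (`(a,b) ≠ 0`) are non-torsion. -/
theorem floor_of_expOnePiAlgebraicIndependent (h : ExpOnePiAlgebraicIndependent) :
    LinearIndependent ℚ ![(1 : ℝ), Real.exp 1, Real.pi] ∧
      Irrational (Real.pi / Real.exp 1) ∧ Irrational (Real.exp 1 * Real.pi) := by
  refine ⟨linearIndependent_one_e_pi_iff.mpr (intLinearForms_of_expOnePiAlgebraicIndependent h),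
    ?_, (transcendental_mul_of_algebraicIndependent h).irrational⟩
  rw [irrational_iff_ne_rational]
  intro a b hb hab
  have he : Real.exp 1 ≠ 0 := (Real.exp_pos 1).ne'
  rw [div_eq_div_iff he (by exact_mod_cast hb : (b : ℝ) ≠ 0)] at hab
  -- `π b = a e`, i.e. `0 + (-a) e + b π = 0`
  have := intLinearForms_of_expOnePiAlgebraicIndependent h 0 (-a) b
    (by push_cast; linear_combination hab)
  exact hb this.2.2

/-- Auxiliary: if `e^{iθ}` is algebraic (`θ` real, `θ ≠ 0`) then `trdeg ℚ(1, iθ, e, e^{iθ}) ≤ 1`;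
so `SchanuelRank 2` at `(1, iθ)` makes `e^{iθ}` transcendental. -/
theorem transcendental_cexp_mul_I_of_schanuelRank_two (h : SchanuelRank 2) {θ : ℝ} (hθ : θ ≠ 0)
    (hθe : (θ : ℂ) ∈ adjoin ℚ ({cexp 1} : Set ℂ)) : Transcendental ℚ (cexp ((θ : ℂ) * I)) := by
  intro halg
  have hli : LinearIndependent ℚ ![(1 : ℂ), (θ : ℂ) * I] := by
    have h' := linearIndependent_re_imI one_ne_zero hθ
    rwa [Complex.ofReal_one] at h'
  have h2 := h _ hli
  -- the generated field sits inside `ℚ(e)(i, e^{iθ})`, of transcendence degree `≤ 1`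
  set S : Set ℂ := Set.range ![cexp 1] with hS
  set T : Set ℂ := {I, cexp ((θ : ℂ) * I)} with hT
  have hTalg : ∀ x ∈ T, IsAlgebraic ℚ x := by
    rintro x (rfl | rfl)
    exacts [isAlgebraic_I, halg]
  have hle : adjoin ℚ (Set.range ![(1 : ℂ), (θ : ℂ) * I] ∪
      Set.range (cexp ∘ ![(1 : ℂ), (θ : ℂ) * I])) ≤ adjoin ℚ (S ∪ T) := by
    have hST : adjoin ℚ ({cexp 1} : Set ℂ) ≤ adjoin ℚ (S ∪ T) :=
      adjoin.mono ℚ _ _ (by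
        rintro x rfl
        exact Or.inl ⟨0, rfl⟩)
    have hθ' : (θ : ℂ) ∈ adjoin ℚ (S ∪ T) := hST hθe
    have hI : I ∈ adjoin ℚ (S ∪ T) := subset_adjoin ℚ _ (Or.inr (by simp [hT]))
    have hex : cexp ((θ : ℂ) * I) ∈ adjoin ℚ (S ∪ T) := subset_adjoin ℚ _ (Or.inr (by simp [hT]))
    have he : cexp 1 ∈ adjoin ℚ (S ∪ T) := subset_adjoin ℚ _ (Or.inl ⟨0, rfl⟩)
    rw [adjoin_le_iff]
    rintro w (⟨i, rfl⟩ | ⟨i, rfl⟩)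
    · fin_cases i
      · exact one_mem _
      · exact mul_mem hθ' hI
    · fin_cases i
      · exact he
      · exact hex
  have h1' : Algebra.trdeg ℚ ↥(adjoin ℚ S) ≤ ((1 : ℕ) : Cardinal) := by
    rw [hS]
    exact trdeg_adjoin_range_le (F := ℚ) ![cexp 1]
  have h1 := (trdeg_adjoin_union_eq_of_isAlgebraic S T hTalg).trans_le h1'
  have h21 : ((2 : ℕ) : Cardinal) ≤ ((1 : ℕ) : Cardinal) := (h2.trans (trdeg_mono hle)).trans h1
  have : (2 : ℕ) ≤ 1 := by exact_mod_cast h21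
  omega

/-- **`SchanuelRank 2 ⟹ e^{ie}` is transcendental** (instance `(1, ie)`; in particular not a
root of unity, so `π/e ∉ ℚ`). -/
theorem transcendental_cexp_exp_one_mul_I_of_schanuelRank_two (h : SchanuelRank 2) :
    Transcendental ℚ (cexp (cexp 1 * I)) := by
  have h' := transcendental_cexp_mul_I_of_schanuelRank_two h (Real.exp_pos 1).ne'
    (by rw [Complex.ofReal_exp, Complex.ofReal_one]; exact subset_adjoin ℚ _ rfl)
  rwa [Complex.ofReal_exp, Complex.ofReal_one] at h'

/-- **`SchanuelRank 2 ⟹ e^{i/e}` is transcendental** (instance `(1, i/e)`; so `eπ ∉ ℚ`). -/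
theorem transcendental_cexp_inv_exp_one_mul_I_of_schanuelRank_two (h : SchanuelRank 2) :
    Transcendental ℚ (cexp ((cexp 1)⁻¹ * I)) := by
  have h' := transcendental_cexp_mul_I_of_schanuelRank_two h (inv_ne_zero (Real.exp_pos 1).ne')
    (by
      rw [Complex.ofReal_inv, Complex.ofReal_exp, Complex.ofReal_one]
      exact inv_mem (subset_adjoin ℚ _ rfl))
  rwa [Complex.ofReal_inv, Complex.ofReal_exp, Complex.ofReal_one] at h'

/-- **The summit gives the whole floor**: `1, e, π` `ℚ`-linearly independent, `π/e ∉ ℚ`,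
`eπ ∉ ℚ`, `e^{ie}` and `e^{i/e}` transcendental. -/
theorem floor_of_schanuel (h : _root_.Schanuel) :
    LinearIndependent ℚ ![(1 : ℝ), Real.exp 1, Real.pi] ∧
      Irrational (Real.pi / Real.exp 1) ∧ Irrational (Real.exp 1 * Real.pi) ∧
      Transcendental ℚ (cexp (cexp 1 * I)) ∧ Transcendental ℚ (cexp ((cexp 1)⁻¹ * I)) :=
  have hf := floor_of_expOnePiAlgebraicIndependent (expOnePiAlgebraicIndependent_of_schanuelRank_two (h 2))
  ⟨hf.1, hf.2.1, hf.2.2, transcendental_cexp_exp_one_mul_I_of_schanuelRank_two (h 2),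
    transcendental_cexp_inv_exp_one_mul_I_of_schanuelRank_two (h 2)⟩

end Summit.Schanuel.Schanuel.Theorems

end
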